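import Mathlib.MeasureTheory.Constructions.HaarToSphere
import Mathlib.MeasureTheory.Measure.Lebesgue.VolumeOfBalls
import Mathlib.Analysis.InnerProductSpace.PiL2
import HarnessLib

/-!
# Radial affine maps of `ℝ³` about a centre: polar coordinates and the volume comparison along rays

Analysis/FluidPDE support file for the proof of the nonlinear estimate `Y₆` of Tao 2011, §10
(arXiv:1108.1165, proof of Thm. 10.1, p. 33), in the annular geometry of Remark 10.6. The
"parent ball" chaining of the printed proof ("for any small ball `Bᵢ`, we may assign a 'parent'
ball `B_{p(i)}` which touches the ball but has radius at least `1.001` as large […] one verifies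
that `Σ_{k≥0}(1+k)^{10} Σ_{i: pᵏ(i)=j} rᵢ⁴ ≲ rⱼ⁴`") is realised, for the continuous Whitney family
of `TaoWhitneyKernel`, by moving points *radially*: the step map about the centre `x₀` with pivot
radius `p` and factor `μ`,

  `radialStep x₀ p μ (x₀ + rα) = x₀ + (p + μ(r - p))α`   (`r > 0`, `|α| = 1`),

multiplies the depth `r - p` (inner layer, `p = a`, `r > a`) resp. `p - r` (outer layer, `p = b`,
`r < b`) by `μ`. The counting estimates of the printed proof become the **volume comparison**

* `lintegral_shell_comp_radialStep_le` — for measurable `G ≥ 0`, `μ ≥ 1` and a shell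
  `{r₁ < |y - x₀| < r₂}` on which `r² ≤ K (p + μ(r - p))²`:
  `∫_{r₁<|y-x₀|<r₂} G(T y) dy ≤ K μ⁻¹ ∫_{s₁<|z-x₀|<s₂} G(z) dz`, `sᵢ = p + μ(rᵢ - p)`,

proved along rays: polar coordinates about `x₀` for the lower Lebesgue integral
(`lintegral_eq_lintegral_sphere_polar`, Mathlib's `measurePreserving_homeomorphUnitSphereProd`;
cf. the tree's `Literature.MathematicalPhysics.QuantumManyBody.lintegral_eq_lintegral_sphere`) and the
affine substitution `s = p + μ(r - p)` on each ray (`Real.map_volume_mul_left`), with the weight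
comparison `r² ≤ K s²`.

## References

* T. Tao, arXiv:1108.1165 (`Tao2011`), §10, proof of Thm. 10.1 (p. 33, the parent balls and the
  two counting estimates) and Remark 10.6.
-/

noncomputable section

open MeasureTheory Set Function Filter Metric Topology
open scoped ENNReal NNReal

namespace Literature.Analysis.FluidPDE

/-- Local notation for physical space `ℝ³ = EuclideanSpace ℝ (Fin 3)`. -/
local notation "ℝ³" => EuclideanSpace ℝ (Fin 3)

/-- Local notation for the surface measure on the unit sphere of `ℝ³` induced by Lebesgue measure. -/
local notation "σ₂" => (Measure.toSphere (volume : Measure (EuclideanSpace ℝ (Fin 3))))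

/-! ### Polar coordinates for the lower Lebesgue integral -/

section Polar

/-- **Polar coordinates in `ℝ³`**: `∫ G = ∫_{S²} dσ(α) ∫_0^∞ G(rα) r² dr` for measurable
`G : ℝ³ → [0, ∞]` (Mathlib's `measurePreserving_homeomorphUnitSphereProd` and Tonelli).
[folklore] -/
theorem lintegral_eq_lintegral_sphere_polar (G : ℝ³ → ℝ≥0∞) (hG : Measurable G) :
    ∫⁻ x, G x = ∫⁻ α : sphere (0 : ℝ³) 1,
      (∫⁻ r in Ioi (0 : ℝ), G (r • (α : ℝ³)) * ENNReal.ofReal (r ^ 2)) ∂σ₂ := by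
  set e := homeomorphUnitSphereProd ℝ³ with he
  have hmp := Measure.measurePreserving_homeomorphUnitSphereProd (volume : Measure ℝ³)
  rw [finrank_euclideanSpace_fin] at hmp
  calc ∫⁻ x, G x = ∫⁻ x in ({0}ᶜ : Set ℝ³), G x := by rw [restrict_compl_singleton]
    _ = ∫⁻ x : ({0}ᶜ : Set ℝ³), G x ∂(volume.comap Subtype.val) :=
        (lintegral_subtype_comap (measurableSet_singleton (0 : ℝ³)).compl G).symm
    _ = ∫⁻ x : ({0}ᶜ : Set ℝ³), (G ∘ Subtype.val ∘ e.symm) (e x)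
          ∂(volume.comap Subtype.val) := by
        simp
    _ = ∫⁻ q, (G ∘ Subtype.val ∘ e.symm) q
          ∂((volume : Measure ℝ³).toSphere.prod (Measure.volumeIoiPow (3 - 1))) :=
        hmp.lintegral_comp_emb e.measurableEmbedding _
    _ = ∫⁻ α : sphere (0 : ℝ³) 1, (∫⁻ r : Ioi (0 : ℝ), G ((r : ℝ) • (α : ℝ³))
          ∂(Measure.volumeIoiPow 2)) ∂σ₂ := by
        rw [lintegral_prod _ (Measurable.aemeasurable ?_)]
        · simp [he, homeomorphUnitSphereProd]
        · exact hG.comp (measurable_subtype_coe.comp e.symm.measurable)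
    _ = _ := by
        refine lintegral_congr fun α => ?_
        have hm : Measurable fun r : Ioi (0 : ℝ) => G ((r : ℝ) • (α : ℝ³)) :=
          hG.comp (measurable_subtype_coe.smul_const _)
        rw [Measure.volumeIoiPow, lintegral_withDensity_eq_lintegral_mul _ (by fun_prop) hm,
          ← lintegral_subtype_comap measurableSet_Ioi
            (fun r : ℝ => G (r • (α : ℝ³)) * ENNReal.ofReal (r ^ 2))]
        refine lintegral_congr fun r => ?_
        simp [mul_comm]

/-- **Polar coordinates about a centre `x₀`**: `∫ G = ∫_{S²} dσ(α) ∫_0^∞ G(x₀ + rα) r² dr`.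
[folklore] -/
theorem lintegral_eq_lintegral_sphere_polar_center (x₀ : ℝ³) (G : ℝ³ → ℝ≥0∞) (hG : Measurable G) :
    ∫⁻ y, G y = ∫⁻ α : sphere (0 : ℝ³) 1,
      (∫⁻ r in Ioi (0 : ℝ), G (x₀ + r • (α : ℝ³)) * ENNReal.ofReal (r ^ 2)) ∂σ₂ := by
  rw [← lintegral_add_left_eq_self G x₀]
  exact lintegral_eq_lintegral_sphere_polar (fun x => G (x₀ + x)) (hG.comp (measurable_const_add x₀))

end Polar

/-! ### The radial step map -/

section Step

variable {x₀ : ℝ³} {p μ : ℝ}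

/-- **The radial step map** about `x₀` with pivot radius `p` and factor `μ`:
`T(y) = x₀ + (p + μ(|y - x₀| - p)) · (y - x₀)/|y - x₀|` (for `y = x₀` the junk value `x₀`). On the
ray `y = x₀ + rα`, `r > 0`, `|α| = 1`: `T(y) = x₀ + (p + μ(r - p))α`. [cite: Tao2011, §10, proof of Thm. 10.1 (p. 33, parent balls) + Remark 10.6] -/
def radialStep (x₀ : ℝ³) (p μ : ℝ) (y : ℝ³) : ℝ³ :=
  x₀ + (p + μ * (‖y - x₀‖ - p)) • (‖y - x₀‖⁻¹ • (y - x₀))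

/-- Unfolding the step map. [folklore] -/
theorem radialStep_apply (x₀ : ℝ³) (p μ : ℝ) (y : ℝ³) :
    radialStep x₀ p μ y = x₀ + (p + μ * (‖y - x₀‖ - p)) • (‖y - x₀‖⁻¹ • (y - x₀)) := rfl

/-- The step map on a ray: `T(x₀ + rα) = x₀ + (p + μ(r - p))α` for `r > 0`, `|α| = 1`. [folklore] -/
theorem radialStep_ray {r : ℝ} (hr : 0 < r) {α : ℝ³} (hα : ‖α‖ = 1) :
    radialStep x₀ p μ (x₀ + r • α) = x₀ + (p + μ * (r - p)) • α := by
  rw [radialStep_apply, add_sub_cancel_left, norm_smul, Real.norm_of_nonneg hr.le, hα, mul_one,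
    smul_smul, smul_smul, mul_assoc, inv_mul_cancel₀ hr.ne', mul_one]

/-- The step map is measurable. [folklore] -/
theorem measurable_radialStep (x₀ : ℝ³) (p μ : ℝ) : Measurable (radialStep x₀ p μ) := by
  unfold radialStep
  have h1 : Measurable fun y : ℝ³ => ‖y - x₀‖ := (measurable_id.sub_const x₀).norm
  exact measurable_const.add ((measurable_const.add (measurable_const.mul (h1.sub_const p))).smul
    (h1.inv.smul (measurable_id.sub_const x₀)))

/-- The distance of `T(y)` from the centre: `|T(y) - x₀| = |p + μ(|y - x₀| - p)|` for `y ≠ x₀`.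
[folklore] -/
theorem norm_radialStep_sub {y : ℝ³} (hy : y ≠ x₀) :
    ‖radialStep x₀ p μ y - x₀‖ = |p + μ * (‖y - x₀‖ - p)| := by
  have hr : 0 < ‖y - x₀‖ := norm_pos_iff.2 (sub_ne_zero.2 hy)
  rw [radialStep_apply, add_sub_cancel_left, norm_smul, norm_smul, norm_inv, norm_norm,
    inv_mul_cancel₀ hr.ne', mul_one, Real.norm_eq_abs]

/-- The displacement of the step map: `|T(y) - y| = |μ - 1| · ||y - x₀| - p|` for `y ≠ x₀`
(on the inner layer, `p = a < |y - x₀|`, this is `(μ - 1)` times the depth). [folklore] -/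
theorem norm_radialStep_sub_self {y : ℝ³} (hy : y ≠ x₀) :
    ‖radialStep x₀ p μ y - y‖ = |μ - 1| * |‖y - x₀‖ - p| := by
  have hr0 : 0 < ‖y - x₀‖ := norm_pos_iff.2 (sub_ne_zero.2 hy)
  set r := ‖y - x₀‖ with hr
  set u : ℝ³ := r⁻¹ • (y - x₀) with hu
  have hun : ‖u‖ = 1 := by
    rw [hu, norm_smul, norm_inv, Real.norm_of_nonneg hr0.le, ← hr, inv_mul_cancel₀ hr0.ne']
  have hy' : y = x₀ + r • u := by
    rw [hu, smul_smul, mul_inv_cancel₀ hr0.ne', one_smul, add_sub_cancel]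
  have hT : radialStep x₀ p μ y = x₀ + (p + μ * (r - p)) • u := rfl
  rw [hT]
  conv_lhs => rw [hy']
  rw [add_sub_add_left_eq_sub, ← sub_smul, norm_smul, hun, mul_one, Real.norm_eq_abs,
    show p + μ * (r - p) - r = (μ - 1) * (r - p) by ring, abs_mul]

end Step

/-! ### The volume comparison along rays -/

section Volume

variable {x₀ : ℝ³} {p μ : ℝ}

/-- The open shell `{r₁ < |y - x₀| < r₂}`. [folklore] -/
def openShell (x₀ : ℝ³) (r₁ r₂ : ℝ) : Set ℝ³ := {y | r₁ < ‖y - x₀‖ ∧ ‖y - x₀‖ < r₂}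

/-- Membership in the shell. [folklore] -/
theorem mem_openShell {x₀ : ℝ³} {r₁ r₂ : ℝ} {y : ℝ³} :
    y ∈ openShell x₀ r₁ r₂ ↔ r₁ < ‖y - x₀‖ ∧ ‖y - x₀‖ < r₂ := Iff.rfl

/-- The shell is open, hence measurable. [folklore] -/
theorem measurableSet_openShell (x₀ : ℝ³) (r₁ r₂ : ℝ) : MeasurableSet (openShell x₀ r₁ r₂) := by
  have h : Continuous fun y : ℝ³ => ‖y - x₀‖ := (continuous_id.sub continuous_const).norm
  exact ((isOpen_lt continuous_const h).inter (isOpen_lt h continuous_const)).measurableSet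

/-- **Affine substitution for the lower integral on `ℝ`**: `∫ F(μr + c) dr = μ⁻¹ ∫ F` for `μ > 0`.
[folklore] -/
theorem lintegral_comp_mul_add (hμ : 0 < μ) (c : ℝ) (F : ℝ → ℝ≥0∞) :
    ∫⁻ r, F (μ * r + c) = ENNReal.ofReal μ⁻¹ * ∫⁻ s, F s := by
  have h1 : ∫⁻ r, F (μ * r + c) = ∫⁻ r, F (μ * r) := by
    have h := lintegral_add_right_eq_self (μ := (volume : Measure ℝ)) (fun r => F (μ * r)) (c / μ)
    rw [← h]
    refine lintegral_congr fun r => ?_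
    congr 1
    field_simp
  rw [h1]
  have h2 : ∫⁻ r, F (μ * r) = ∫⁻ s, F s ∂(Measure.map (μ * ·) volume) :=
    (lintegral_map_equiv F (Homeomorph.mulLeft₀ μ hμ.ne').toMeasurableEquiv).symm
  rw [h2, Real.map_volume_mul_left hμ.ne', lintegral_smul_measure, abs_of_pos (inv_pos.2 hμ),
    smul_eq_mul]

/-- **The ray computation.** For `H : ℝ → [0,∞]`, `μ ≥ 1`, and
`K ≥ 0` with `r² ≤ K (p + μ(r - p))²` for `r ∈ (r₁, r₂)`:
`∫_{(r₁,r₂)} H(p + μ(r - p)) r² dr ≤ K μ⁻¹ ∫_{(s₁,s₂)} H(s) s² ds`, `sᵢ = p + μ(rᵢ - p)`. [folklore] -/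
theorem lintegral_ray_comp_affine_le (H : ℝ → ℝ≥0∞) (hμ : 1 ≤ μ) {r₁ r₂ K : ℝ}
    (hK0 : 0 ≤ K) (hK : ∀ r ∈ Ioo r₁ r₂, r ^ 2 ≤ K * (p + μ * (r - p)) ^ 2) :
    ∫⁻ r in Ioo r₁ r₂, H (p + μ * (r - p)) * ENNReal.ofReal (r ^ 2) ≤
      ENNReal.ofReal K * ENNReal.ofReal μ⁻¹ *
        ∫⁻ s in Ioo (p + μ * (r₁ - p)) (p + μ * (r₂ - p)), H s * ENNReal.ofReal (s ^ 2) := by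
  have hμ0 : 0 < μ := one_pos.trans_le hμ
  set s₁ := p + μ * (r₁ - p) with hs₁
  set s₂ := p + μ * (r₂ - p) with hs₂
  -- the majorant on `ℝ`
  set F : ℝ → ℝ≥0∞ := fun s => (Ioo s₁ s₂).indicator (fun s => H s * ENNReal.ofReal (s ^ 2)) s with hF
  have hmem : ∀ r, r ∈ Ioo r₁ r₂ ↔ p + μ * (r - p) ∈ Ioo s₁ s₂ := fun r => by
    simp only [mem_Ioo, hs₁, hs₂]
    constructor
    · rintro ⟨h1, h2⟩; constructor <;> nlinarith
    · rintro ⟨h1, h2⟩; constructor <;> nlinarith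
  have hpt : ∀ r, (Ioo r₁ r₂).indicator (fun r => H (p + μ * (r - p)) * ENNReal.ofReal (r ^ 2)) r ≤
      ENNReal.ofReal K * F (μ * r + (p - μ * p)) := by
    intro r
    have hs : μ * r + (p - μ * p) = p + μ * (r - p) := by ring
    by_cases hr : r ∈ Ioo r₁ r₂
    · rw [indicator_of_mem hr]
      have hFr : F (μ * r + (p - μ * p)) =
          H (p + μ * (r - p)) * ENNReal.ofReal ((p + μ * (r - p)) ^ 2) := by
        rw [hs]
        show (Ioo s₁ s₂).indicator (fun s => H s * ENNReal.ofReal (s ^ 2)) (p + μ * (r - p)) = _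
        rw [indicator_of_mem ((hmem r).1 hr)]
      rw [hFr]
      calc H (p + μ * (r - p)) * ENNReal.ofReal (r ^ 2)
          ≤ H (p + μ * (r - p)) * (ENNReal.ofReal K * ENNReal.ofReal ((p + μ * (r - p)) ^ 2)) := by
            gcongr
            rw [← ENNReal.ofReal_mul hK0]
            exact ENNReal.ofReal_le_ofReal (hK r hr)
        _ = ENNReal.ofReal K * (H (p + μ * (r - p)) * ENNReal.ofReal ((p + μ * (r - p)) ^ 2)) := by
            ring
    · rw [indicator_of_notMem hr]
      exact bot_le
  calc ∫⁻ r in Ioo r₁ r₂, H (p + μ * (r - p)) * ENNReal.ofReal (r ^ 2)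
      = ∫⁻ r, (Ioo r₁ r₂).indicator (fun r => H (p + μ * (r - p)) * ENNReal.ofReal (r ^ 2)) r :=
        (lintegral_indicator measurableSet_Ioo _).symm
    _ ≤ ∫⁻ r, ENNReal.ofReal K * F (μ * r + (p - μ * p)) := lintegral_mono hpt
    _ = ENNReal.ofReal K * (ENNReal.ofReal μ⁻¹ * ∫⁻ s, F s) := by
        rw [lintegral_const_mul' _ _ ENNReal.ofReal_ne_top, lintegral_comp_mul_add hμ0]
    _ = ENNReal.ofReal K * ENNReal.ofReal μ⁻¹ * ∫⁻ s in Ioo s₁ s₂, H s * ENNReal.ofReal (s ^ 2) := by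
        rw [hF, lintegral_indicator measurableSet_Ioo, mul_assoc]

/-- **Volume comparison for the radial step map** (the continuous form of Tao's counting
estimates for parent balls). Let `G : ℝ³ → [0,∞]` be measurable, `μ ≥ 1`, `0 ≤ r₁ ≤ r₂`, and
`K ≥ 0` with `r² ≤ K (p + μ(r - p))²` and `0 < p + μ(r - p)` for `r ∈ (r₁, r₂)`. Then
`∫_{r₁<|y-x₀|<r₂} G(T y) dy ≤ K μ⁻¹ ∫_{s₁<|z-x₀|<s₂} G(z) dz`, `sᵢ = p + μ(rᵢ - p)`
(`T = radialStep x₀ p μ`). [cite: Tao2011, §10, proof of Thm. 10.1 (p. 33, "Σ_{k≥0}(1+k)^{10}Σ_{i:pᵏ(i)=j} rᵢ⁴ ≲ rⱼ⁴")] -/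
theorem lintegral_shell_comp_radialStep_le {G : ℝ³ → ℝ≥0∞} (hG : Measurable G) (hμ : 1 ≤ μ)
    {r₁ r₂ K : ℝ} (hr₁ : 0 ≤ r₁) (hK0 : 0 ≤ K)
    (hK : ∀ r ∈ Ioo r₁ r₂, r ^ 2 ≤ K * (p + μ * (r - p)) ^ 2)
    (hpos : ∀ r ∈ Ioo r₁ r₂, 0 < p + μ * (r - p)) :
    ∫⁻ y in openShell x₀ r₁ r₂, G (radialStep x₀ p μ y) ≤
      ENNReal.ofReal K * ENNReal.ofReal μ⁻¹ *
        ∫⁻ z in openShell x₀ (p + μ * (r₁ - p)) (p + μ * (r₂ - p)), G z := by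
  set s₁ := p + μ * (r₁ - p) with hs₁
  set s₂ := p + μ * (r₂ - p) with hs₂
  have hSm := measurableSet_openShell x₀ r₁ r₂
  have hS'm := measurableSet_openShell x₀ s₁ s₂
  -- both sides in polar coordinates about `x₀`
  have hL : ∫⁻ y in openShell x₀ r₁ r₂, G (radialStep x₀ p μ y) =
      ∫⁻ α : sphere (0 : ℝ³) 1, (∫⁻ r in Ioi (0 : ℝ),
        (openShell x₀ r₁ r₂).indicator (fun y => G (radialStep x₀ p μ y)) (x₀ + r • (α : ℝ³)) *
          ENNReal.ofReal (r ^ 2)) ∂σ₂ := by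
    rw [← lintegral_indicator hSm]
    exact lintegral_eq_lintegral_sphere_polar_center x₀ _
      (((hG.comp (measurable_radialStep x₀ p μ))).indicator hSm)
  have hR : ∫⁻ z in openShell x₀ s₁ s₂, G z =
      ∫⁻ α : sphere (0 : ℝ³) 1, (∫⁻ s in Ioi (0 : ℝ),
        (openShell x₀ s₁ s₂).indicator G (x₀ + s • (α : ℝ³)) * ENNReal.ofReal (s ^ 2)) ∂σ₂ := by
    rw [← lintegral_indicator hS'm]
    exact lintegral_eq_lintegral_sphere_polar_center x₀ _ (hG.indicator hS'm)
  rw [hL, hR, ← lintegral_const_mul' _ _ (ENNReal.mul_ne_top ENNReal.ofReal_ne_top ENNReal.ofReal_ne_top)]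
  refine lintegral_mono fun α => ?_
  have hα : ‖(α : ℝ³)‖ = 1 := by simp
  -- the ray function `H(s) = G(x₀ + sα)`
  set H : ℝ → ℝ≥0∞ := fun s => G (x₀ + s • (α : ℝ³)) with hHdef
  -- rewrite the inner integrals as integrals over the radial intervals
  have hnorm : ∀ r : ℝ, 0 < r → ‖x₀ + r • (α : ℝ³) - x₀‖ = r := fun r hr => by
    rw [add_sub_cancel_left, norm_smul, Real.norm_of_nonneg hr.le, hα, mul_one]
  have hLi : ∫⁻ r in Ioi (0 : ℝ), (openShell x₀ r₁ r₂).indicator (fun y => G (radialStep x₀ p μ y))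
        (x₀ + r • (α : ℝ³)) * ENNReal.ofReal (r ^ 2) =
      ∫⁻ r in Ioo r₁ r₂, H (p + μ * (r - p)) * ENNReal.ofReal (r ^ 2) := by
    rw [← lintegral_indicator measurableSet_Ioi, ← lintegral_indicator measurableSet_Ioo]
    refine lintegral_congr fun r => ?_
    by_cases hr : r ∈ Ioo r₁ r₂
    · have hr0 : 0 < r := hr₁.trans_lt hr.1
      have hmem : x₀ + r • (α : ℝ³) ∈ openShell x₀ r₁ r₂ := by
        rw [mem_openShell, hnorm r hr0]; exact hr
      rw [indicator_of_mem (mem_Ioi.2 hr0), indicator_of_mem hr, indicator_of_mem hmem, hHdef]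
      simp only
      rw [radialStep_ray hr0 hα]
    · rw [indicator_of_notMem hr]
      by_cases hr0 : r ∈ Ioi (0 : ℝ)
      · rw [indicator_of_mem hr0, indicator_of_notMem, zero_mul]
        rw [mem_openShell, hnorm r hr0]
        exact hr
      · rw [indicator_of_notMem hr0]
  have hRi : ∫⁻ s in Ioi (0 : ℝ), (openShell x₀ s₁ s₂).indicator G (x₀ + s • (α : ℝ³)) *
        ENNReal.ofReal (s ^ 2) = ∫⁻ s in Ioo s₁ s₂, H s * ENNReal.ofReal (s ^ 2) := by
    rw [← lintegral_indicator measurableSet_Ioi, ← lintegral_indicator measurableSet_Ioo]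
    refine lintegral_congr fun s => ?_
    by_cases hs : s ∈ Ioo s₁ s₂
    · -- `s > 0` since `s₁ ≥ 0`? we only know `0 < p + μ(r - p)` on the open interval; use it
      have hs0 : 0 < s := by
        -- `s = p + μ(r - p)` for `r = p + (s - p)/μ ∈ (r₁, r₂)`
        have hμ0 : 0 < μ := one_pos.trans_le hμ
        set r := p + (s - p) / μ with hr
        have hsr : s = p + μ * (r - p) := by rw [hr]; field_simp; ring
        have hrmem : r ∈ Ioo r₁ r₂ := by
          rw [mem_Ioo] at hs ⊢
          rw [hs₁, hs₂] at hs
          constructor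
          · by_contra h; push Not at h
            have : s ≤ s₁ := by rw [hsr, hs₁]; nlinarith
            linarith [hs.1]
          · by_contra h; push Not at h
            have : s₂ ≤ s := by rw [hsr, hs₂]; nlinarith
            linarith [hs.2]
        rw [hsr]; exact hpos r hrmem
      have hmem : x₀ + s • (α : ℝ³) ∈ openShell x₀ s₁ s₂ := by
        rw [mem_openShell, hnorm s hs0]; exact hs
      rw [indicator_of_mem (mem_Ioi.2 hs0), indicator_of_mem hs, indicator_of_mem hmem]
    · rw [indicator_of_notMem hs]
      by_cases hs0 : s ∈ Ioi (0 : ℝ)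
      · rw [indicator_of_mem hs0, indicator_of_notMem, zero_mul]
        rw [mem_openShell, hnorm s hs0]
        exact hs
      · rw [indicator_of_notMem hs0]
  rw [hLi, hRi]
  exact lintegral_ray_comp_affine_le H hμ hK0 hK

end Volume

end Literature.Analysis.FluidPDE

end
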